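import Summits.QuantumFields.BalabanUV.T4Continuum.Support.NE3LocalCrudePair
import Summits.QuantumFields.BalabanUV.T4Continuum.Support.AveragingDeficitCounting
import Summits.QuantumFields.BalabanUV.T4Continuum.Support.MinimalActionRefine
import HarnessLib

/-!
# T⁴ programme, node NE3 — the LOCAL half, reading (D), CRUDE fixed-torus route, part 2:
# THE β′-loc WINDOW TERMS FROM SUP-FORM REGULARITY, AND THE PAIR BOUND WITH ALL INPUTS NAMED

NE3 prover lineage P1, gen 18 (cell `pub-balaban`, unit `b2b-balaban-t4-ne3-p1`, row NE3 OWNER; journal NOTE l.10685).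

CONTENT (0 def, 0 sorry; bookkeeping): §1 cardinalities `card_blockSites_le` (`#B(Y) ≤ #Y·L^d`), `card_nbhd_le`
(`#N_R(T) ≤ #T·(2R+1)^d`); §2 `gradFluxL1_le_of_pointwise`, `gradFluxSq_le_of_pointwise` (a pointwise bound `γ` on
`‖(∇_V F)(x,κ;π)‖` gives `≤ #S·d·#Pl·γ`, `≤ #S·d·#Pl·γ²`); §3 **`abs_windowAction_sub_le_of_regularSup`** — part 1's read-out with
EVERY input named: `U_B` with `RegularSup d L N b c (k+1)` (B11 Thm 1 (8)+(9)_{β=1} TYPE data of the run-(k+1) minimiser), the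
transport facts `isUnitaryCfg_rescale_bavg` ∕ `smallField_rescale_bavg` (B7 Prop. 1) for `W`, a gauge `u` and an `M`-periodic skew
direction `Z` with `gaugeAct u U_A = vary W Z 1`, a window `Y ⊆ periodBox M`:
`|L^{d−4}A_Y(U_A) − A_{B(Y)}(U_B)| ≤ wallConstLoc·#Y·(d·#Pl·L^d(4L+1)^d·(a_B·γ + γ²) + a_B³)
   + L^{d−4}·(avgRadius(a_B)·√(#Y·#Pl)·E + 14·#Pl·E²)`,
`a_B = b/(L^{k+1})²`, `γ = c/(L^{k+1})³`, `E = energyNorm W Z (periodBox M)` — the GLOBAL energy norm, no localisation.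
Part 3 feeds `E ≤ C·residualScale` (P2's ROOT T-E) and the level scaling `#Y = L^{dk}`, `M = N·L^k`.

HONEST FRAMING.  **NE3 is NOT proved**; the representation `gaugeAct u U_A = vary W Z 1` and the energy bound are what T-E
supplies (a typed hypothesis of the row), the regularity of `U_B` is (H∃)'s; nothing printed is a hypothesis; no conditional of
the cell; no `def`, no `sorry`, axioms ⊆ {propext, Classical.choice, Quot.sound}.  Finite T⁴ rung (B)+1 — NOT infinite volume, NOT
a mass gap, NOT the Clay problem, NOT summit progress.  PLACEMENT: `Summits/QuantumFields/BalabanUV/`.  HONEST DEPENDENCY (cell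
page 1): continuum YM on T⁴ ⇐ BetaPertH ∧ nine spine estimates (0/9 proved); BetaPertH ⇐ (D1) ∧ (D4) ∧ CAP+tail; G-an2-4 gates
asym, D1 and NE2/3/4.
-/

set_option autoImplicit false

open scoped BigOperators Matrix Matrix.Norms.L2Operator
open NormedSpace Finset

namespace Summit.QuantumFields.BalabanUV.T4Continuum.NE3LocalCrudeWindow

open Literature.MathematicalPhysics.QuantumFieldTheory.Balaban1983to89
open B7Prop1Explicit B7Prop2Explicit MatrixLog UnitaryModel
open T4AveragingDeficitWall hiding Site Plane Plaq Bond
open T4AveragingDeficitWallBoundary (gradFluxL1 periodBox blockSites_eq_image)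
open T4AveragingDeficitNonAbelian (wallConstLoc)
open AveragingDeficitPeriodicCounting (IsPeriodicDir)
open AveragingDeficitCounting (card_box_eq)
open MinimalActionLevels (avgRadius isUnitaryCfg_rescale_bavg smallField_rescale_bavg)
open MinimalActionRefine (RegularSup)
open NE3EnergyShapes (energyNorm energyNorm_nonneg)
open NE3EnergySource (fhol_sub_one_le_of_smallField)
open NE3HessBounds (bondSq)
open NE3LocalCrudePair

noncomputable section

variable {d : ℕ} {n : Type*} [Fintype n] [DecidableEq n] [Nonempty n]

/-! ## §1 Cardinalities -/

omit [Fintype n] [DecidableEq n] [Nonempty n] in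
/-- `#B(Y) ≤ #Y · L^d`. [folklore] -/
theorem card_blockSites_le (L : ℕ) (Y : Finset (Site d)) : ((blockSites L Y).card : ℝ) ≤ Y.card * (L : ℝ) ^ d := by
  rw [blockSites_eq_image]
  have h := Finset.card_image_le (s := Y ×ˢ (Finset.univ : Finset (Fin d → Fin L)))
    (f := fun yr : Site d × (Fin d → Fin L) => (L : ℤ) • yr.1 + boxVec L yr.2)
  rw [Finset.card_product, Finset.card_univ, Fintype.card_fun, Fintype.card_fin, Fintype.card_fin] at h
  exact_mod_cast h

omit [Fintype n] [DecidableEq n] [Nonempty n] in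
/-- `#N_R(T) ≤ #T · (2R+1)^d`. [folklore] -/
theorem card_nbhd_le (R : ℕ) (T : Finset (Site d)) : ((nbhd R T).card : ℝ) ≤ T.card * ((2 * R + 1 : ℕ) : ℝ) ^ d := by
  unfold T4AveragingDeficitWall.nbhd
  have h := Finset.card_biUnion_le (s := T) (t := box R)
  simp only [card_box_eq, Finset.sum_const, smul_eq_mul] at h
  exact_mod_cast h

/-! ## §2 The gradient functionals from a pointwise bound -/

omit [Nonempty n] in
/-- `‖∇F‖_{ℓ¹(S)} ≤ #S·d·#Pl·γ` from a pointwise bound `γ`. [folklore] -/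
theorem gradFluxL1_le_of_pointwise {V : Site d → Fin d → (Matrix n n ℂ)ˣ} {γ : ℝ}
    (hγ : ∀ (x : Site d) (κ : Fin d) (π : T4AveragingDeficitWall.Plane d), ‖covGrad V (flux V) x κ π‖ ≤ γ)
    (S : Finset (Site d)) :
    gradFluxL1 V S ≤ S.card * (d * (Fintype.card (T4AveragingDeficitWall.Plane d) * γ)) := by
  unfold T4AveragingDeficitWallBoundary.gradFluxL1
  have h : ∀ x ∈ S, ∑ κ : Fin d, ∑ π : T4AveragingDeficitWall.Plane d, ‖covGrad V (flux V) x κ π‖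
      ≤ d * (Fintype.card (T4AveragingDeficitWall.Plane d) * γ) := by
    intro x _
    calc ∑ κ : Fin d, ∑ π : T4AveragingDeficitWall.Plane d, ‖covGrad V (flux V) x κ π‖
        ≤ ∑ _κ : Fin d, ∑ _π : T4AveragingDeficitWall.Plane d, γ :=
          Finset.sum_le_sum fun κ _ => Finset.sum_le_sum fun π _ => hγ x κ π
      _ = d * (Fintype.card (T4AveragingDeficitWall.Plane d) * γ) := by
          simp only [Finset.sum_const, Finset.card_univ, Fintype.card_fin, nsmul_eq_mul]
  calc ∑ x ∈ S, ∑ κ : Fin d, ∑ π : T4AveragingDeficitWall.Plane d, ‖covGrad V (flux V) x κ π‖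
      ≤ ∑ _x ∈ S, (d : ℝ) * (Fintype.card (T4AveragingDeficitWall.Plane d) * γ) := Finset.sum_le_sum h
    _ = S.card * (d * (Fintype.card (T4AveragingDeficitWall.Plane d) * γ)) := by
        rw [Finset.sum_const, nsmul_eq_mul]

omit [Nonempty n] in
/-- `‖∇F‖²_{ℓ²(S)} ≤ #S·d·#Pl·γ²` from a pointwise bound `γ`. [folklore] -/
theorem gradFluxSq_le_of_pointwise {V : Site d → Fin d → (Matrix n n ℂ)ˣ} {γ : ℝ}
    (hγ : ∀ (x : Site d) (κ : Fin d) (π : T4AveragingDeficitWall.Plane d), ‖covGrad V (flux V) x κ π‖ ≤ γ)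
    (S : Finset (Site d)) :
    gradFluxSq V S ≤ S.card * (d * (Fintype.card (T4AveragingDeficitWall.Plane d) * γ ^ 2)) := by
  unfold gradFluxSq
  have h : ∀ x ∈ S, ∑ κ : Fin d, ∑ π : T4AveragingDeficitWall.Plane d, ‖covGrad V (flux V) x κ π‖ ^ 2
      ≤ d * (Fintype.card (T4AveragingDeficitWall.Plane d) * γ ^ 2) := by
    intro x _
    calc ∑ κ : Fin d, ∑ π : T4AveragingDeficitWall.Plane d, ‖covGrad V (flux V) x κ π‖ ^ 2
        ≤ ∑ _κ : Fin d, ∑ _π : T4AveragingDeficitWall.Plane d, γ ^ 2 :=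
          Finset.sum_le_sum fun κ _ => Finset.sum_le_sum fun π _ =>
            pow_le_pow_left₀ (norm_nonneg _) (hγ x κ π) 2
      _ = d * (Fintype.card (T4AveragingDeficitWall.Plane d) * γ ^ 2) := by
          simp only [Finset.sum_const, Finset.card_univ, Fintype.card_fin, nsmul_eq_mul]
  calc ∑ x ∈ S, ∑ κ : Fin d, ∑ π : T4AveragingDeficitWall.Plane d, ‖covGrad V (flux V) x κ π‖ ^ 2
      ≤ ∑ _x ∈ S, (d : ℝ) * (Fintype.card (T4AveragingDeficitWall.Plane d) * γ ^ 2) := Finset.sum_le_sum h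
    _ = S.card * (d * (Fintype.card (T4AveragingDeficitWall.Plane d) * γ ^ 2)) := by
        rw [Finset.sum_const, nsmul_eq_mul]

/-! ## §3 The pair bound with all inputs named -/

/-- **THE TWO-LEVEL LOCAL ACTION READ-OUT FROM SUP-FORM REGULARITY AND THE GLOBAL ENERGY NORM.**  For `L ≥ 1`, a run-(k+1)
configuration `U_B` with `RegularSup d L N b c (k+1)` (`b ≥ 0`, `c ≥ 0`, `512(d+1)(d+4)L²·b ≤ 1`), its rescaled average
`W = rescale L (bavg L U_B)`, a configuration `U_A`, a site gauge `u` and an `M`-periodic skew direction `Z` (`M ≥ 1`) with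
`gaugeAct u U_A = vary W Z 1`, and a finite window `Y ⊆ periodBox M`:
`|L^{d−4}·A_Y(U_A) − A_{B(Y)}(U_B)| ≤ wallConstLoc·#Y·(L^d(4L+1)^d·d·#Pl·(a_B·γ + γ²) + a_B³)
   + L^{d−4}·(avgRadius(a_B)·√(#Y·#Pl)·E + 14·#Pl·E²)`
with `a_B = b/(L^{k+1})²`, `γ = c/(L^{k+1})³`, `E = energyNorm W Z (periodBox M)`. [folklore] -/
theorem abs_windowAction_sub_le_of_regularSup (L : ℕ) (hL : 1 ≤ L) {N k : ℕ} {b c : ℝ} (hb : 0 ≤ b) (hc : 0 ≤ c)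
    (hbs : 512 * (d + 1) * (d + 4) * (L : ℝ) ^ 2 * b ≤ 1)
    {UB UA : Site d → Fin d → (Matrix n n ℂ)ˣ} (hreg : RegularSup d L N b c (k + 1) UB)
    {Z : Site d → Fin d → Matrix n n ℂ} (hZ : IsSkewDir Z) {M : ℕ} (hM : 1 ≤ M) (hZp : IsPeriodicDir Z (M : ℤ))
    {u : Site d → (Matrix n n ℂ)ˣ} (hrep : gaugeAct u UA = vary (rescale L (bavg L UB)) Z 1)
    {Y : Finset (Site d)} (hY : Y ⊆ periodBox M) :
    |(L : ℝ) ^ ((d : ℤ) - 4) * fineAction UA (Y ×ˢ Finset.univ) - fineAction UB (blockSites L Y ×ˢ Finset.univ)|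
      ≤ wallConstLoc d L * (Y.card * ((L : ℝ) ^ d * ((2 * (2 * L) + 1 : ℕ) : ℝ) ^ d
            * (d * (Fintype.card (T4AveragingDeficitWall.Plane d)
              * ((b / ((L : ℝ) ^ (k + 1)) ^ 2) * (c / ((L : ℝ) ^ (k + 1)) ^ 3) + (c / ((L : ℝ) ^ (k + 1)) ^ 3) ^ 2)))
            + (b / ((L : ℝ) ^ (k + 1)) ^ 2) ^ 3))
        + (L : ℝ) ^ ((d : ℤ) - 4) * (avgRadius d L (b / ((L : ℝ) ^ (k + 1)) ^ 2)
            * (Real.sqrt (Y.card * Fintype.card (T4AveragingDeficitWall.Plane d))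
              * energyNorm (rescale L (bavg L UB)) Z (periodBox M))
          + 14 * Fintype.card (T4AveragingDeficitWall.Plane d) * energyNorm (rescale L (bavg L UB)) Z (periodBox M) ^ 2) := by
  have hL1 : (1 : ℝ) ≤ L := by exact_mod_cast hL
  -- the scales of level k+1
  set aB : ℝ := b / ((L : ℝ) ^ (k + 1)) ^ 2 with haBdef
  set γ : ℝ := c / ((L : ℝ) ^ (k + 1)) ^ 3 with hγdef
  have haB0 : 0 ≤ aB := by positivity
  have hγ0 : 0 ≤ γ := by positivity
  have hs1 : (1 : ℝ) ≤ ((L : ℝ) ^ (k + 1)) ^ 2 := one_le_pow₀ (one_le_pow₀ hL1)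
  have haBb : aB ≤ b := div_le_self hb hs1
  have hsmall : 512 * (d + 1) * (d + 4) * (L : ℝ) ^ 2 * aB ≤ 1 := by
    have h0 : (0 : ℝ) ≤ 512 * (d + 1) * (d + 4) * (L : ℝ) ^ 2 := by positivity
    exact (mul_le_mul_of_nonneg_left haBb h0).trans hbs
  -- `W` is unitary and a small field of radius `avgRadius aB`
  have hW : IsUnitaryCfg (rescale L (bavg L UB)) := isUnitaryCfg_rescale_bavg L hL hreg.unitary haB0 hsmall hreg.small
  have hWa : SmallField (rescale L (bavg L UB)) (avgRadius d L aB) :=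
    smallField_rescale_bavg L hL hreg.unitary haB0 hsmall hreg.small
  -- part 1's read-out
  have hpair := abs_windowAction_sub_le' L hL hreg.unitary hW haB0 hsmall hreg.small hZ hrep Y
    (fhol_sub_one_le_of_smallField hWa _)
  -- the window terms
  set S := nbhd (2 * L) (blockSites L Y) with hSdef
  have hcardS : (S.card : ℝ) ≤ Y.card * ((L : ℝ) ^ d * ((2 * (2 * L) + 1 : ℕ) : ℝ) ^ d) := by
    have h1 := card_nbhd_le (d := d) (2 * L) (blockSites L Y)
    have h2 := card_blockSites_le (d := d) L Y
    have h3 : (0 : ℝ) ≤ ((2 * (2 * L) + 1 : ℕ) : ℝ) ^ d := by positivity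
    calc (S.card : ℝ) ≤ (blockSites L Y).card * ((2 * (2 * L) + 1 : ℕ) : ℝ) ^ d := h1
      _ ≤ Y.card * (L : ℝ) ^ d * ((2 * (2 * L) + 1 : ℕ) : ℝ) ^ d := mul_le_mul_of_nonneg_right h2 h3
      _ = Y.card * ((L : ℝ) ^ d * ((2 * (2 * L) + 1 : ℕ) : ℝ) ^ d) := by ring
  have hG1 := (gradFluxL1_le_of_pointwise hreg.grad S).trans
    (mul_le_mul_of_nonneg_right hcardS (by positivity))
  have hG2 := (gradFluxSq_le_of_pointwise hreg.grad S).trans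
    (mul_le_mul_of_nonneg_right hcardS (by positivity))
  -- the direction terms against the global energy norm
  have hdir := dirTerms_le_energyNorm (rescale L (bavg L UB)) M hM hZp hY
    (a := avgRadius d L aB) (by unfold MinimalActionLevels.avgRadius; positivity)
  have hw : 0 ≤ (L : ℝ) ^ ((d : ℤ) - 4) := zpow_nonneg (Nat.cast_nonneg L) _
  have hWc : 0 ≤ wallConstLoc d L := by
    unfold T4AveragingDeficitNonAbelian.wallConstLoc
    have := T4AveragingDeficitNonAbelian.wallConstNA_nonneg (d := d) L
    positivity
  -- assemble
  refine hpair.trans (add_le_add ?_ (mul_le_mul_of_nonneg_left hdir hw))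
  refine mul_le_mul_of_nonneg_left ?_ hWc
  have e1 : aB * (↑Y.card * ((L : ℝ) ^ d * ((2 * (2 * L) + 1 : ℕ) : ℝ) ^ d)
        * (↑d * (↑(Fintype.card (T4AveragingDeficitWall.Plane d)) * γ)))
      + ↑Y.card * ((L : ℝ) ^ d * ((2 * (2 * L) + 1 : ℕ) : ℝ) ^ d)
        * (↑d * (↑(Fintype.card (T4AveragingDeficitWall.Plane d)) * γ ^ 2)) + aB ^ 3 * ↑Y.card
      = ↑Y.card * ((L : ℝ) ^ d * ((2 * (2 * L) + 1 : ℕ) : ℝ) ^ d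
        * (↑d * (↑(Fintype.card (T4AveragingDeficitWall.Plane d)) * (aB * γ + γ ^ 2))) + aB ^ 3) := by ring
  rw [← e1]
  have h3 := mul_le_mul_of_nonneg_left hG1 haB0
  linarith

end

end Summit.QuantumFields.BalabanUV.T4Continuum.NE3LocalCrudeWindow
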